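import Literature.AnabelianGeometry.AbsoluteAnabelian.AbsTopIProp23AlmostProSigmaOuterFaithfulTF
import HarnessLib

/-!
# [AbsTopI] Prop 2.3 (i) at the ALMOST pro-`Σ` model: (FN) is EQUIVALENT to outer-faithfulness

S. Mochizuki, *Topics in Absolute Anabelian Geometry I: Generalities*, J. Math. Sci. Univ. Tokyo **19**
(2012) [AbsTopI], Def 2.1 (i) p. 18 (GFG-type: `Δ` the maximal ALMOST pro-`Σ` quotient of `Δ_X` attached
to a finite étale Galois covering `Y → X`, containing the open normal pro-`Σ` surface group `U := Δ_Y^Σ`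
with `Δ / U = Gal(Y/X)`), Prop 2.3 (i) p. 19.

PROOF-ONLY companion (abc-iut cell, seat abc-iut-f-053; no definitions, no named facts) of
`AbsTopIProp23AlmostProSigmaOuterFaithful.lean` / `…OuterFaithfulTF.lean` (abc-iut-w6-d071).  Those files
prove Prop 2.2 / 2.3 for a profinite `Δ` with an open NORMAL subgroup `U` presented as a pro-`Σ` completion
of a hyperbolic surface group `Γ_{g,r}`, from the single residual input (OF) «every element of `Δ` acting
on `U` as an inner automorphism of `U` lies in `U`» (`Δ/U ↪ Out U`), via the input (FN) «`Δ` has no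
nontrivial finite normal subgroup» of the model theorems ((OF) + torsion-freeness of `U` ⟹ (FN)).
THIS FILE proves the CONVERSE direction and packages the equivalence:

* `centralizer_eq_bot_of_forall_finite_normal_eq_bot` — for `U` open normal in a compact group with
  `Z(U) = 1`: (FN) ⟹ `Z_Δ(U) = 1` (the centraliser of `U` is a normal subgroup meeting `U` in `Z(U) = 1`,
  hence injecting into the finite `Δ/U`: a finite normal subgroup);
* `outerFaithful_of_forall_finite_normal_eq_bot` — hence (FN) ⟹ (OF);
* `forall_finite_normal_eq_bot_iff_outerFaithful` — **(FN) ⟺ (OF)** at the almost pro-`Σ` model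
  (`Z(U) = 1` by slimness of the pro-`Σ` surface group; ⇐ is abc-iut-w6-d030's
  `finite_normal_eq_bot_of_torsionFree_of_centralizer_eq_bot` with torsion-freeness from the tree);
* `FundamentalExtension.geom_forall_finite_normal_eq_bot_iff_outerFaithful` — the same inside `Δ = E.geom`
  of an extension `1 → Δ → Π → G → 1`.

So the residual ORIGIN(FN) of the cell's node AbsTopI:Prop2.3(i) at the almost pro-`Σ` model is EXACTLY
(no weaker, no stronger than) the faithfulness of the outer action of `Gal(Y/X)` on `Δ_Y^Σ`.  HONEST SCOPE:
that clause is genuinely geometric and is NOT discharged here.  Classical profinite group theory; OUR kernel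
check; nothing here bears on [IUTchIII] Cor. 3.12; no side is taken.
-/

noncomputable section

open Topology

universe u

namespace Literature.AnabelianGeometry.AbsoluteAnabelian

open Literature.AlgebraicGeometry.Frobenioids (IsSlimGroup)
open Literature.AnabelianGeometry.SemiGraphs.SemiGraphOfAnabelioids
open Literature.GroupTheory.CombinatorialGroupTheory

variable {G : Type u} [Group G] [TopologicalSpace G] [IsTopologicalGroup G] [CompactSpace G]

/-! ### (FN) forces the outer action on an open normal centre-free subgroup to be faithful -/

/-- **(FN) ⇒ `Z_G(U) = 1`** for `U` open normal in a compact group `G` with trivial centre: the centraliser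
`Z_G(U)` is a normal subgroup of `G`, meets `U` in `Z(U) = 1`, hence injects into the finite group `G/U`;
so it is a FINITE normal subgroup, and (FN) «`G` has no nontrivial finite normal subgroup» kills it.
[cite: MochizukiAbsTopI2012, Prop 2.3 (i) p.19] -/
theorem centralizer_eq_bot_of_forall_finite_normal_eq_bot (U : Subgroup G) [hUn : U.Normal]
    (hUo : IsOpen (U : Set G)) (hZ : Subgroup.centralizer ((⊤ : Subgroup U) : Set U) = ⊥)
    (hFN : ∀ N : Subgroup G, N.Normal → (N : Set G).Finite → N = ⊥) :
    Subgroup.centralizer (U : Set G) = ⊥ := by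
  set C := Subgroup.centralizer (U : Set G) with hC
  -- `C` is normal (the centraliser of a normal subgroup)
  haveI hCn : C.Normal := by
    refine ⟨fun c hc x => ?_⟩
    rw [hC, Subgroup.mem_centralizer_iff] at hc ⊢
    intro y hy
    have h := hc (x⁻¹ * y * x) (by simpa [mul_assoc] using hUn.conj_mem' y hy x)
    calc y * (x * c * x⁻¹) = x * ((x⁻¹ * y * x) * c) * x⁻¹ := by group
      _ = x * (c * (x⁻¹ * y * x)) * x⁻¹ := by rw [h]
      _ = x * c * x⁻¹ * y := by group
  -- `C ⊓ U = Z(U) = 1`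
  have hCU : C ⊓ U = ⊥ := by
    rw [eq_bot_iff]
    intro x hx
    have hx' : (⟨x, hx.2⟩ : U) ∈ Subgroup.centralizer ((⊤ : Subgroup U) : Set U) := by
      rw [Subgroup.mem_centralizer_iff]
      rintro ⟨y, hy⟩ -
      exact Subtype.ext ((Subgroup.mem_centralizer_iff.mp hx.1) y hy)
    rw [hZ, Subgroup.mem_bot] at hx'
    exact (Subgroup.mem_bot).mpr (congrArg Subtype.val hx')
  -- `C` injects into the finite `G ⧸ U`, hence is finite
  haveI : Finite (G ⧸ U) := Subgroup.quotient_finite_of_isOpen U hUo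
  have hinj : Function.Injective (fun c : C => (QuotientGroup.mk (s := U) (c : G))) := by
    intro a b hab
    have h : ((a : G))⁻¹ * (b : G) ∈ U := QuotientGroup.eq.mp hab
    have h' : ((a : G))⁻¹ * (b : G) ∈ C ⊓ U := ⟨C.mul_mem (C.inv_mem a.2) b.2, h⟩
    rw [hCU, Subgroup.mem_bot] at h'
    exact Subtype.ext (inv_mul_eq_one.mp h')
  haveI : Finite C := Finite.of_injective _ hinj
  exact hFN C hCn (Set.toFinite _)

/-- **(FN) ⇒ outer-faithful** for `U` open normal with `Z(U) = 1` in a compact group: under (FN), an element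
of `G` acting on `U` as an inner automorphism of `U` lies in `U`
(`centralizer_eq_bot_of_forall_finite_normal_eq_bot` + abc-iut-w6-d030's
`centralizer_eq_bot_iff_mem_of_conj_eq_conj`). [cite: MochizukiAbsTopI2012, Prop 2.3 (i) p.19] -/
theorem outerFaithful_of_forall_finite_normal_eq_bot (U : Subgroup G) [U.Normal] (hUo : IsOpen (U : Set G))
    (hZ : Subgroup.centralizer ((⊤ : Subgroup U) : Set U) = ⊥)
    (hFN : ∀ N : Subgroup G, N.Normal → (N : Set G).Finite → N = ⊥) :
    ∀ x : G, (∃ u ∈ U, ∀ y ∈ U, x * y * x⁻¹ = u * y * u⁻¹) → x ∈ U :=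
  (centralizer_eq_bot_iff_mem_of_conj_eq_conj U hZ).mp
    (centralizer_eq_bot_of_forall_finite_normal_eq_bot U hUo hZ hFN)

/-! ### The equivalence at the almost pro-`Σ` model -/

variable [T2Space G] [TotallyDisconnectedSpace G]

/-- **At the almost pro-`Σ` model, (FN) ⟺ outer-faithfulness.**  For `G` profinite and `U ≤ G` open normal
presented as a pro-`Σ` completion of a hyperbolic `Γ_{g,r}` (`Σ` a nonempty set of primes): «`G` has no
nontrivial finite normal subgroup» iff «every element of `G` acting on `U` as an inner automorphism of `U`
lies in `U`» (`G/U ↪ Out U`).  (⇒: `outerFaithful_of_forall_finite_normal_eq_bot`, with `Z(U) = 1` from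
slimness of the pro-`Σ` model; ⇐: torsion-freeness of `U` — the tree's theorem, via
`torsionFree_of_isOpen_proSigma_hyperbolic` — and `Z_G(U) = 1`.)  The residual input ORIGIN(FN) of the cell's
node AbsTopI:Prop2.3(i) at the almost pro-`Σ` model is therefore EXACTLY the faithfulness of the outer
action of `Gal(Y/X) = Δ/Δ_Y^Σ` on `Δ_Y^Σ`. [cite: MochizukiAbsTopI2012, Prop 2.3 (i) p.19] -/
theorem forall_finite_normal_eq_bot_iff_outerFaithful {Sigma : Set ℕ} (hS : Sigma.Nonempty)
    (hSp : ∀ p ∈ Sigma, p.Prime) {g r : ℕ} (hgr : PuncturedSurfaceGroup.IsHyperbolicType g r)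
    (U : Subgroup G) [U.Normal] (hUo : IsOpen (U : Set G)) (ι : PuncturedSurfaceGroup g r →* U)
    (hι : IsProSigmaCompletion Sigma ι) :
    (∀ N : Subgroup G, N.Normal → (N : Set G).Finite → N = ⊥) ↔
      ∀ x : G, (∃ u ∈ U, ∀ y ∈ U, x * y * x⁻¹ = u * y * u⁻¹) → x ∈ U := by
  have hZ : Subgroup.centralizer ((⊤ : Subgroup U) : Set U) = ⊥ :=
    centralizer_top_eq_bot_of_isOpen_proSigma_hyperbolic hS hSp hgr U hUo ι hι
  refine ⟨outerFaithful_of_forall_finite_normal_eq_bot U hUo hZ, fun hOut => ?_⟩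
  exact finite_normal_eq_bot_of_torsionFree_of_centralizer_eq_bot U
    (torsionFree_of_isOpen_proSigma_hyperbolic hgr U hUo ι hι)
    ((centralizer_eq_bot_iff_mem_of_conj_eq_conj U hZ).mpr hOut)

/-- **Prop 2.3 (i) at the almost pro-`Σ` model is EQUALLY available from (FN) or from (OF)** — the
conclusions `IsSlimGroup G ∧ IsElastic G` from (FN), re-derived through the equivalence (sanity composition
with abc-iut-w6-d071's `slim_and_elastic_of_isOpen_proSigma_hyperbolic_of_outerFaithful'`).
[cite: MochizukiAbsTopI2012, Prop 2.3 (i) p.19] -/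
theorem slim_and_elastic_of_isOpen_normal_proSigma_hyperbolic_of_forall_finite_normal_eq_bot
    {Sigma : Set ℕ} (hS : Sigma.Nonempty) (hSp : ∀ p ∈ Sigma, p.Prime) {g r : ℕ}
    (hgr : PuncturedSurfaceGroup.IsHyperbolicType g r) (U : Subgroup G) [U.Normal] (hUo : IsOpen (U : Set G))
    (ι : PuncturedSurfaceGroup g r →* U) (hι : IsProSigmaCompletion Sigma ι)
    (hFN : ∀ N : Subgroup G, N.Normal → (N : Set G).Finite → N = ⊥) : IsSlimGroup G ∧ IsElastic G :=
  slim_and_elastic_of_isOpen_proSigma_hyperbolic_of_outerFaithful' hS hSp hgr U hUo ι hι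
    ((forall_finite_normal_eq_bot_iff_outerFaithful hS hSp hgr U hUo ι hι).mp hFN)

namespace FundamentalExtension

/-- **The node's residual, packaged for extensions**: for `1 → Δ → Π → G → 1` and `U ≤ Δ = E.geom` open
normal presented as a pro-`Σ` completion of a hyperbolic `Γ_{g,r}`, the input (FN) of the cell's Prop 2.3 (i)
model theorems is EQUIVALENT to the outer-faithfulness of `Δ/U` on `U`.
[cite: MochizukiAbsTopI2012, Prop 2.3 (i) p.19] -/
theorem geom_forall_finite_normal_eq_bot_iff_outerFaithful (E : FundamentalExtension.{u}) {Sigma : Set ℕ}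
    (hS : Sigma.Nonempty) (hSp : ∀ p ∈ Sigma, p.Prime) {g r : ℕ}
    (hgr : PuncturedSurfaceGroup.IsHyperbolicType g r) (U : Subgroup E.geom) [U.Normal]
    (hUo : IsOpen (U : Set E.geom)) (ι : PuncturedSurfaceGroup g r →* U) (hι : IsProSigmaCompletion Sigma ι) :
    (∀ N : Subgroup E.geom, N.Normal → (N : Set E.geom).Finite → N = ⊥) ↔
      ∀ x : E.geom, (∃ u ∈ U, ∀ y ∈ U, x * y * x⁻¹ = u * y * u⁻¹) → x ∈ U := by
  haveI : CompactSpace E.geom := isCompact_iff_compactSpace.mp E.isClosed_geom.isCompact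
  exact forall_finite_normal_eq_bot_iff_outerFaithful hS hSp hgr U hUo ι hι

end FundamentalExtension

end Literature.AnabelianGeometry.AbsoluteAnabelian

end
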